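import Literature.NumberTheory.GaloisRepresentations.DecomposedGeneric
import Literature.NumberTheory.GaloisRepresentations.FrobeniusPlaces
import Literature.NumberTheory.GaloisRepresentations.SplitsCompletelyCriteria
import HarnessLib

/-!
# Decomposed generic primes are stable under restriction to extensions in which they split

Topic `NumberTheory/GaloisRepresentations` (vocabulary of `DecomposedGeneric.lean`:
`IsGenericAt τ v`, `SplitsCompletely K p`, `IsDecomposedGenericPrime τ p`, `IsDecomposedGeneric τ`
for a homomorphism `τ : Γ_K →* GL_n(k)`; of `AbsGaloisGroup.lean` / `AbsIntegersEquiv.lean` /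
`FrobeniusPlaces.lean`: the restriction `res = absGaloisRestrict F M : Γ_M → Γ_F` for an
extension `M/F` of number fields, under which inertia groups and — at places of residue degree
one — arithmetic Frobenius elements correspond; of `FrobeniusDensityTheorem.lean`:
`splitPrimes F M`).  Theorem-only file (no definition, no named fact, D-0026): the "wanted API"
recorded in `DecomposedGeneric.lean` ("NOT here: … stability under restriction to extensions in
which `p` splits").

The occurrence formalised is the step of the proof of ACC+ Thm. 6.1.1 (Allen–Calegari–Caraiani–
Gee–Helm–Le Hung–Newton–Scholze–Taylor–Thorne, *Potential automorphy over CM fields*, Ann. of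
Math. 197 (2023), §6.5.12, arXiv:1812.09999 p. 88):

> There exists a rational prime `p₀ ≠ p` which is decomposed generic for `ρ̄`, and `V₂` is equal
> to the set of `p₀`-adic places of `F`. […] If `E/F` is any finite Galois extension which is
> `V₀ ∪ V₁ ∪ V₂`-split, then […] `ρ̄|_{G_E}` is decomposed generic. Indeed, the rational prime
> `p₀` splits in `E`.

* `IsGenericAt.comp_absGaloisRestrict` — if `τ` is generic at the place `v` of `F` and `w ∣ v`
  is a place of `M` of residue degree `f(w|v) = 1`, then `τ ∘ res` is generic at `w`
  (`res(I_𝔔) ≤ I_{ι⁻¹𝔔}`, `absGaloisRestrict_mem_inertia_comap`; a Frobenius at `𝔔 ∣ w`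
  restricts to a Frobenius at `ι⁻¹ 𝔔 ∣ v` when `f = 1`,
  `isArithFrobAt_absGaloisRestrict_of_inertiaDeg_eq_one`; `q_w = q_v`).
* `IsDecomposedGenericPrime.comp_absGaloisRestrict` — **if `p₀` is decomposed generic for `τ`
  and splits completely in `M`, then `p₀` is decomposed generic for `τ ∘ res : Γ_M → GL_n(k)`**;
  `IsDecomposedGeneric` version.
* `SplitsCompletely.of_forall_mem_splitPrimes` — `p₀` splits completely in `F` and every place
  of `F` above `p₀` splits completely in `M` ⟹ `p₀` splits completely in `M` (`e`, `f`
  multiplicative in `ℤ ⊆ 𝓞 F ⊆ 𝓞 M`, Mathlib `Ideal.ramificationIdx_tower`,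
  `Ideal.inertiaDeg_tower`) — the printed "Indeed, the rational prime `p₀` splits in `E`" for a
  `V₂`-split `E`.

These serve the named fact
`Literature.NumberTheory.Automorphic.ACCGHLNSTT2023.automorphyLifting_crystalline_weightZero`
(`Automorphic/ACCAutomorphyLiftingCrystalline.lean`), whose hypothesis (3) is
`IsDecomposedGeneric τ` for a residual representation `τ` of `ρ`.

## References

* [ACCGHLNSTT2023] P. B. Allen et al., *Potential automorphy over CM fields*, Ann. of Math. (2)
  197 (2023), 897–1113, Def. 4.3.1 and §6.5.12 (arXiv:1812.09999, pp. 34, 88).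
* [NeukirchANT1999] J. Neukirch, *Algebraic Number Theory* (1999), Ch. I §8 (towers: `e`, `f`
  multiplicative), §9 (9.4)–(9.5) (Frobenius under restriction).
-/

noncomputable section

open NumberField IsDedekindDomain Field Ideal

open scoped MatrixGroups Classical

namespace Literature.NumberTheory.GaloisRepresentations

section Generic

variable {F M : Type} [Field F] [NumberField F] [Field M] [NumberField M] [Algebra F M]
variable {k : Type*} [Field k] {n : ℕ}

/-- **Genericity passes to places of residue degree one upstairs.**  Let `M/F` be an extension of
number fields, `τ : Γ_F →* GL_n(k)` generic at the place `v` of `F` (ACC+ Def. 4.3.1), and `w` a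
place of `M` above `v` with `f(w|v) = 1`.  Then `τ ∘ res : Γ_M → GL_n(k)` is generic at `w`:
`res` maps the inertia group of a prime `𝔔 ∣ w` of `\bar ℤ_M` into that of `ι⁻¹ 𝔔 ∣ v`, and an
arithmetic Frobenius at `𝔔` to an arithmetic Frobenius at `ι⁻¹ 𝔔` (as `q_w = q_v`), where the
eigenvalue condition of `τ` holds. [cite: ACCGHLNSTT2023, Def. 4.3.1 and §6.5.12]
[cite: NeukirchANT1999, Ch. I §9 (9.4)] -/
theorem IsGenericAt.comp_absGaloisRestrict {τ : absoluteGaloisGroup F →* GL (Fin n) k}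
    {v : HeightOneSpectrum (𝓞 F)} (hτ : IsGenericAt τ v) {w : HeightOneSpectrum (𝓞 M)}
    (hw : w.asIdeal.under (𝓞 F) = v.asIdeal) (hf : w.asIdeal.inertiaDeg (𝓞 F) = 1) :
    IsGenericAt (τ.comp (absGaloisRestrict F M).toMonoidHom) w := by
  refine ⟨fun 𝔔 h𝔔 σ hσ => ?_, fun 𝔔 h𝔔 σ hσ => ?_⟩
  · -- inertia: `res σ ∈ I_{ι⁻¹ 𝔔}`, `ι⁻¹ 𝔔 ∣ v`
    exact hτ.1 _ (comap_absIntegersMap_mem_primesAbove hw h𝔔) _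
      (absGaloisRestrict_mem_inertia_comap F M hσ)
  · -- Frobenius: `res σ` is an arithmetic Frobenius at `ι⁻¹ 𝔔 ∣ v`, and `q_w = q_v`
    have hΦ := isArithFrobAt_absGaloisRestrict_of_inertiaDeg_eq_one hw h𝔔 hσ hf
    have hq : w.residueCard = v.residueCard := by
      rw [residueCard_eq_residueCard_pow_inertiaDeg hw, hf, pow_one]
    rw [hq]
    exact hτ.2 _ (comap_absIntegersMap_mem_primesAbove hw h𝔔) _ hΦ

/-- **Decomposed generic primes are stable under restriction to extensions in which they split
completely** (ACC+ §6.5.12: "`ρ̄|_{G_E}` is decomposed generic. Indeed, the rational prime `p₀`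
splits in `E`").  If `p₀` is decomposed generic for `τ : Γ_F →* GL_n(k)` and splits completely
in the extension `M` of `F`, then `p₀` is decomposed generic for `τ ∘ res : Γ_M → GL_n(k)`: every
place `w ∣ p₀` of `M` lies above a place `v ∣ p₀` of `F` with `q_w = p₀ = q_v`, so `f(w|v) = 1`
and `IsGenericAt.comp_absGaloisRestrict` applies. [cite: ACCGHLNSTT2023, Def. 4.3.1 and
§6.5.12] -/
theorem IsDecomposedGenericPrime.comp_absGaloisRestrict {τ : absoluteGaloisGroup F →* GL (Fin n) k}
    {p : ℕ} (hτ : IsDecomposedGenericPrime τ p) (hM : SplitsCompletely M p) :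
    IsDecomposedGenericPrime (τ.comp (absGaloisRestrict F M).toMonoidHom) p := by
  obtain ⟨hp, hchar, hF, hgen⟩ := hτ
  refine ⟨hp, hchar, hM, fun w hw => ?_⟩
  -- the place `v = w ∩ F` of `F` below `w`; it lies above `p`
  set v : HeightOneSpectrum (𝓞 F) := w.under (𝓞 F) with hv
  have hvw : w.asIdeal.under (𝓞 F) = v.asIdeal := rfl
  have hpv : ((p : ℕ) : 𝓞 F) ∈ v.asIdeal := by
    change ((p : ℕ) : 𝓞 F) ∈ w.asIdeal.comap (algebraMap (𝓞 F) (𝓞 M))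
    rw [Ideal.mem_comap, map_natCast]
    exact hw
  -- `q_w = p = q_v`, hence `f(w|v) = 1`
  have hf : w.asIdeal.inertiaDeg (𝓞 F) = 1 := by
    have h := residueCard_eq_residueCard_pow_inertiaDeg (F := F) (M := M) hvw
    rw [hM.2 w hw, hF.2 v hpv] at h
    exact Nat.pow_right_injective hp.two_le ((pow_one p).trans h).symm
  exact (hgen v hpv).comp_absGaloisRestrict hvw hf

/-- `IsDecomposedGeneric` form: a decomposed generic prime of `τ` splitting completely in `M`
makes `τ ∘ res` decomposed generic. [cite: ACCGHLNSTT2023, Def. 4.3.1 and §6.5.12] -/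
theorem IsDecomposedGenericPrime.isDecomposedGeneric_comp_absGaloisRestrict
    {τ : absoluteGaloisGroup F →* GL (Fin n) k} {p : ℕ} (hτ : IsDecomposedGenericPrime τ p)
    (hM : SplitsCompletely M p) :
    IsDecomposedGeneric (τ.comp (absGaloisRestrict F M).toMonoidHom) :=
  (hτ.comp_absGaloisRestrict hM).isDecomposedGeneric

end Generic

/-! ### Complete splitting of `p` ascends a tower `ℚ ⊆ F ⊆ M` when the places above `p` split -/

section Tower

variable {F M : Type*} [Field F] [NumberField F] [Field M] [NumberField M] [Algebra F M]

/-- **`p` splits completely in `F`, and every place of `F` above `p` splits completely in `M`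
⟹ `p` splits completely in `M`** (`e(W|p) = e(v|p) e(W|v) = 1` and `f(W|p) = f(v|p) f(W|v) = 1`
for `W ∣ v ∣ p`; Neukirch I §8).  This is "Indeed, the rational prime `p₀` splits in `E`" of
ACC+ §6.5.12 for a `V₂`-split extension `E/F`, `V₂` the set of `p₀`-adic places of `F`.
[cite: ACCGHLNSTT2023, §6.5.12] [cite: NeukirchANT1999, Ch. I §8] -/
theorem SplitsCompletely.of_forall_mem_splitPrimes {p : ℕ} (hp : p.Prime)
    (hF : SplitsCompletely F p)
    (hsplit : ∀ v : HeightOneSpectrum (𝓞 F), ((p : ℕ) : 𝓞 F) ∈ v.asIdeal → v ∈ splitPrimes F M) :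
    SplitsCompletely M p := by
  have hp0 : span {(p : ℤ)} ≠ ⊥ := by
    rw [ne_eq, span_singleton_eq_bot]; exact_mod_cast hp.ne_zero
  rw [splitsCompletely_iff_forall_inertiaDeg_eq_one hp] at hF ⊢
  obtain ⟨hunrF, hfF⟩ := hF
  -- a prime `W` of `𝓞 M` above `(p)` and the place `v = W ∩ F`, which lies above `(p)` and
  -- splits completely in `M`
  have key : ∀ W : Ideal (𝓞 M), W.IsPrime → W.LiesOver (span {(p : ℤ)}) →
      ∃ v : HeightOneSpectrum (𝓞 F), W.LiesOver v.asIdeal ∧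
        v.asIdeal.LiesOver (span {(p : ℤ)}) ∧ v ∈ splitPrimes F M := by
    intro W hW hWp
    haveI := hW
    haveI := hWp
    have hWne : W ≠ ⊥ := ne_bot_of_liesOver_of_ne_bot hp0 W
    set W' : HeightOneSpectrum (𝓞 M) := ⟨W, hW, hWne⟩ with hW'
    set v : HeightOneSpectrum (𝓞 F) := W'.under (𝓞 F) with hv
    haveI : W.LiesOver v.asIdeal := ⟨rfl⟩
    haveI : v.asIdeal.LiesOver (span {(p : ℤ)}) := Ideal.LiesOver.tower_bot W v.asIdeal _
    exact ⟨v, inferInstance, inferInstance,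
      hsplit v (natCast_mem_of_liesOver_span inferInstance)⟩
  refine ⟨?_, fun W hW => ?_⟩
  · -- unramified: `e(W|p) = e(v|p) · e(W|v) = 1 · 1`
    rw [Algebra.isUnramifiedIn_iff_forall_ramificationIdx_eq_one]
    intro W _ hWp
    obtain ⟨v, hWv, hvp, hvM⟩ := key W inferInstance hWp
    haveI := hWv
    haveI := hvp
    haveI := v.isPrime
    have hev : v.asIdeal.ramificationIdx ℤ = 1 :=
      (Algebra.isUnramifiedIn_iff_forall_ramificationIdx_eq_one.mp hunrF) v.asIdeal hvp
    have heW : W.ramificationIdx (𝓞 F) = 1 :=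
      (Algebra.isUnramifiedIn_iff_forall_ramificationIdx_eq_one.mp (mem_splitPrimes_iff.mp hvM).1)
        W hWv
    rw [Ideal.ramificationIdx_tower v.asIdeal W, hev, heW]
  · -- residue degree: `f(W|p) = f(v|p) · f(W|v) = 1 · 1`
    obtain ⟨v, hWv, hvp, hvM⟩ := key W hW.1 hW.2
    haveI := hW.1
    haveI := hWv
    haveI := hvp
    haveI := v.isPrime
    have hfv : v.asIdeal.inertiaDeg ℤ = 1 := hfF v.asIdeal ⟨v.isPrime, hvp⟩
    have hfW : W.inertiaDeg (𝓞 F) = 1 := (mem_splitPrimes_iff.mp hvM).2 W ⟨hW.1, hWv⟩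
    rw [Ideal.inertiaDeg_tower v.asIdeal W, hfv, hfW]

end Tower

end Literature.NumberTheory.GaloisRepresentations

end
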